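import Summits.RiemannHypothesis.RiemannHypothesis.Theorems.ZetaStringSemilocalDefs
import Summits.RiemannHypothesis.RiemannHypothesis.Theorems.ZetaStringKernelWeilDictionary
import Summits.RiemannHypothesis.RiemannHypothesis.Theorems.SemilocalKinkedWallOffsets
import Summits.RiemannHypothesis.RiemannHypothesis.Theorems.SemilocalCert554Threshold
import Summits.RiemannHypothesis.RiemannHypothesis.Theorems.SemilocalNegCert055747
import Summits.RiemannHypothesis.RiemannHypothesis.Theorems.HandoffLadderTheoremRungs
import Summits.RiemannHypothesis.RiemannHypothesis.Theorems.SemilocalTwoThreeLower8046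
import Summits.RiemannHypothesis.RiemannHypothesis.Theorems.SemilocalNegCertEmpty
import HarnessLib

/-!
# The WEIL ↔ DBR dictionary at the NAMED truncated strings `Ψ_S = semilocalScrew S`, `G_S = semilocalKernel S` (RH-FREE; every row by name)

LINE 1 — LABEL: RH-FREE glue. Every theorem below is an INSTANCE, at the named objects of `Theorems.ZetaStringSemilocalDefs`,
of a hypothesis-style theorem already in the tree (`Theorems.ZetaStringSemilocalKernel` p457721, `…KernelWeilDictionary`
p458498 — hypothesis `hΨ := semilocalScrew_eq S`), or a one-line transport of a Column-WEIL kernel theorem BY NAME (the rows of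
`Theorems.ZetaStringSemilocalKernelRows` p457889 restated at the named kernel, plus `wallOffset_seventeen_lt_0006245`,
`wallOffset_nineteen_lt_000532`, `wallOffset_twentythree_lt_00055`, `SemilocalTwoThree.weilSemilocalPositivityOn_8046`). The two `∀` statements (`Semilocal.riemannHypothesis_iff`,
`Semilocal.riemannHypothesis_iff_forall_window`) are RH-EQUIVALENCES — labelled, NOT claimed. bears_on: LADDER-RH B-D → B-P(P1)
(cell rh-dbr ENGINE-TARGETS §3.1 «ℓ = 2a», §3.4 ET6 necessity depths `δ(N)`; rh-dbr-theory g9 calls of record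
2026-08-26T17:28:58Z (a) + (c)). WHAT THIS IS NOT: progress toward RH; no new certificate; «`δ(q) ≥ 0` for every `q`» is RH
restated and is not asserted.

Dictionary (ENGINE-TARGETS §3.4 notation): `T^S_ℓ ⪰ 0` («the `S`-truncated string of one-sided depth `ℓ` is positive») is
`IsPosSemidefKernelOn (semilocalKernel S) (Ioo 0 ℓ)`; `ℓ*(S) = sup {ℓ : T^S_ℓ ⪰ 0} = 2·weilSemilocalThreshold S`;
for `S = primes < q`: `ℓ*(P_<q) = log q + δ(q)`, `δ(q) = 2·wallOffset q` (Column WEIL's `HandoffMarginLaw.wallOffset`).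

* §1 structure of the named objects: continuity, evenness, value `0` at `0`, `Ψ_∅ = archScrew`, `G_∅ = archKernel`,
  `Ψ_{primes<q} = Ψ` on `|v| < log q` and `G_{primes<q} = G` on `(−a,a)²` for `2a ≤ log q`.
* §2 the identities `P_S(ψ ⋆ ψ̃) = ⟨ψ′,ψ′⟩_{K_{R_S},a}` and **`Q_S(ψ) = ⟨ψ′,ψ′⟩_{G_S,a}`**.
* §3 the dictionary: **`G_S ⪰ 0 on (−a,a) ↔ WeilSemilocalPositivityOn S a`**, one-sided forms, `ℓ*(S) = 2a*(S)`,
  `0 ≤ wallOffset q ↔ G_{primes<q} ⪰ 0 on (0, log q)`, `ArchWallHolds ℓ ↔ G_∅ ⪰ 0 on (0, ℓ)`, the full form through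
  `G_{primes<q}`, and the two RH-EQUIVALENT `∀`-forms (labelled).
* §4 the ET6 rows by name: rungs `q = 3, 5, 7` and `{2}` to `1.108`, `{2,3} ⊆ S` to `1.6092`; ties `{2}` beyond `97/87`,
  `q = 5, 7, 11, 13, 17, 19, 23` (kinked walls) and the uniform «`δ(q) < 0.0142`, `5 ≤ q ≤ 23` prime».

References: M. Suzuki, J. Lond. Math. Soc. (2) 108 (2023) = arXiv:2206.03682, (1.1), (1.4)–(1.5), Prop. 3.1, §4.3;
H. Yoshida, Adv. Stud. Pure Math. 21 (1992) Prop. 6, Lemma 7; A. Connes, Selecta Math. 5 (1999) §VII Thm 4.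
-/

-- `Summit.RiemannHypothesis.RiemannHypothesis.…` duplicates `RiemannHypothesis` BY DESIGN (D-0017).
set_option linter.dupNamespace false

noncomputable section

open MeasureTheory Set Filter
open scoped BigOperators ComplexConjugate

namespace Summit.RiemannHypothesis.RiemannHypothesis.Theorems.ZetaStringArchWall

open Literature.NumberTheory.LFunctions Literature.Analysis.Complex
open Summit.RiemannHypothesis.RiemannHypothesis.Theorems.KreinFormComb
open Summit.RiemannHypothesis.RiemannHypothesis.Theorems.MotivicDoor.SemilocalThreshold
open Summit.RiemannHypothesis.RiemannHypothesis.Theorems.MotivicDoor.SemilocalMarkov (weilSemilocalCoeff_empty)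
open Summit.RiemannHypothesis.RiemannHypothesis.Theorems.HandoffMarginLaw (wallOffset wallOffset_nonneg_iff)
open Summit.RiemannHypothesis.RiemannHypothesis.Theorems.HandoffLadderTheoremRungs
  (wallOffset_three_nonneg wallOffset_five_nonneg)
open Summit.RiemannHypothesis.RiemannHypothesis.Theorems.HandoffLadderRungOne (wallOffset_seven_nonneg)
open Summit.RiemannHypothesis.RiemannHypothesis.Theorems.SemilocalKinkedWallOffsets
open Summit.RiemannHypothesis.RiemannHypothesis.Theorems.SemilocalCert554 (weilSemilocalPositivityOn_two_554)
open Summit.RiemannHypothesis.RiemannHypothesis.Theorems.SemilocalPolyWitness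
  (weilSemilocalThreshold_two_le_055747 wallOffset_seventeen_lt_0006245 wallOffset_nineteen_lt_000532
    wallOffset_twentythree_lt_00055)
open Summit.RiemannHypothesis.RiemannHypothesis.Theorems.SemilocalTwoThree (weilSemilocalPositivityOn_8046)

namespace Semilocal

variable {a : ℝ} (S : Finset ℕ)

/-! ## §1 Structure of `R_S`, `Ψ_S`, `G_S` -/

/-- `R_S` is continuous. [folklore] -/
theorem continuous_semilocalRamp : Continuous (semilocalRamp S) :=
  continuous_ramp (c := weilSemilocalCoeff S) (semilocalRamp_eq S)

/-- `R_S` is even. [folklore] -/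
@[simp] theorem semilocalRamp_neg (v : ℝ) : semilocalRamp S (-v) = semilocalRamp S v :=
  ramp_neg (c := weilSemilocalCoeff S) (semilocalRamp_eq S) v

/-- `R_S(0) = 0`. [folklore] -/
@[simp] theorem semilocalRamp_zero : semilocalRamp S 0 = 0 :=
  ramp_zero (c := weilSemilocalCoeff S) (semilocalRamp_eq S)

/-- `Ψ_S` is continuous. [folklore] -/
theorem continuous_semilocalScrew : Continuous (semilocalScrew S) :=
  ZetaStringArchWall.continuous_semilocalScrew (semilocalScrew_eq S)

/-- `Ψ_S` is even. [folklore] -/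
@[simp] theorem semilocalScrew_neg (v : ℝ) : semilocalScrew S (-v) = semilocalScrew S v :=
  ZetaStringArchWall.semilocalScrew_neg (semilocalScrew_eq S) v

/-- `Ψ_S(0) = 0`. [folklore] -/
@[simp] theorem semilocalScrew_zero : semilocalScrew S 0 = 0 :=
  ZetaStringArchWall.semilocalScrew_zero (semilocalScrew_eq S)

/-- `G_S` is continuous as a function of two variables (real part; the kernel is real). [folklore] -/
theorem continuous_semilocalKernel_real :
    Continuous fun p : ℝ × ℝ => semilocalScrew S p.1 + semilocalScrew S p.2 - semilocalScrew S (p.1 - p.2) :=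
  continuous_kreinKernel_real (continuous_semilocalScrew S)

/-- `R_∅ = 0`: with no primes kept there is no ramp. [folklore] -/
@[simp] theorem semilocalRamp_empty (v : ℝ) : semilocalRamp ∅ v = 0 := by
  simp [semilocalRamp_eq, weilSemilocalCoeff_empty]

/-- `Ψ_∅ = archScrew` — the archimedean wall IS the `∅`-truncated screw function. [folklore] -/
@[simp] theorem semilocalScrew_empty : semilocalScrew ∅ = archScrew := by
  funext v; simp [semilocalScrew_eq_archScrew_sub]

/-- `G_∅ = archKernel`. [folklore] -/
@[simp] theorem semilocalKernel_empty : semilocalKernel ∅ = archKernel := by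
  funext t u; simp [semilocalKernel_apply, archKernel]

/-- On `|v| < log q` Suzuki's `Ψ` IS the `{p < q}`-truncated screw function. [cite: Suzuki2023, (1.1)] -/
theorem zetaScrew_eq_semilocalScrew {q : ℕ} {v : ℝ} (hv : |v| < Real.log q) :
    zetaScrew v = semilocalScrew (Nat.primesBelow q) v :=
  zetaScrew_eq_semilocalScrew_of_abs_lt_log (semilocalScrew_eq _) hv

/-- On the window `(−a, a)²` with `2a ≤ log q`, Suzuki's kernel IS `G_{primes<q}`. [cite: Suzuki2023, (1.4)] -/
theorem zetaScrewKernel_eq_semilocalKernel {q : ℕ} (h2a : 2 * a ≤ Real.log q) {t u : ℝ} (ht : t ∈ Ioo (-a) a)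
    (hu : u ∈ Ioo (-a) a) : (zetaScrewKernel t u : ℂ) = semilocalKernel (Nat.primesBelow q) t u := by
  have hta : |t| < a := abs_lt.2 ⟨ht.1, ht.2⟩
  have hua : |u| < a := abs_lt.2 ⟨hu.1, hu.2⟩
  have htu : |t - u| < 2 * a := abs_sub_lt_iff.2 ⟨by linarith [ht.2, hu.1], by linarith [ht.1, hu.2]⟩
  have ha : a ≤ 2 * a := by linarith [(abs_nonneg t).trans_lt hta]
  rw [semilocalKernel_apply, zetaScrewKernel, zetaScrew_eq_semilocalScrew (q := q) (by linarith),
    zetaScrew_eq_semilocalScrew (q := q) (by linarith), zetaScrew_eq_semilocalScrew (q := q) (by linarith)]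

/-! ## §2 The identities `P_S(ψ ⋆ ψ̃) = ⟨ψ′,ψ′⟩_{K_{R_S},a}` and `Q_S(ψ) = ⟨ψ′,ψ′⟩_{G_S,a}` -/

/-- The `S`-prime term through the ramp kernel: `Σ_{primeFactors n ⊆ S} Λ(n)n^{-1/2}(k(log n) + k(−log n)) = ⟨ψ′,ψ′⟩_{K_{R_S},a}`,
`k = ψ ⋆ ψ̃`, for `0 < a`, `ψ ∈ C(a)`. [cite: Suzuki2023, §4.3 eq. (4.6) and (4.8), arXiv p. 9] -/
theorem weilSemilocalPrimeTerm_eq_rampForm (ha : 0 < a) {ψ : ℝ → ℂ} (hψ : ψ ∈ screwTestC a) :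
    weilSemilocalPrimeTerm S (weilConv ψ (weilReflect ψ)) =
      ∫ t in Ioo (-a) a, ∫ u in Ioo (-a) a,
        kreinKernel (semilocalRamp S) t u * deriv ψ u * conj (deriv ψ t) :=
  weilSemilocalPrimeTerm_eq_kreinForm ha hψ

/-- **`Q_S(ψ) = ⟨ψ′, ψ′⟩_{G_S,a}`** at the named kernel: for `0 < a`, `ψ ∈ C(a)`,
`weilSemilocalQuadratic S ψ = ∫_{(−a,a)}∫_{(−a,a)} G_S(t,u) ψ′(u) conj ψ′(t) du dt`. RH-FREE identity.
[cite: Suzuki2023, Prop 3.1 and §4.3 (4.6)/(4.8)] -/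
theorem weilSemilocalQuadratic_eq_form (ha : 0 < a) {ψ : ℝ → ℂ} (hψ : ψ ∈ screwTestC a) :
    weilSemilocalQuadratic S ψ =
      ∫ t in Ioo (-a) a, ∫ u in Ioo (-a) a, semilocalKernel S t u * deriv ψ u * conj (deriv ψ t) :=
  weilSemilocalQuadratic_eq_semilocalForm (semilocalScrew_eq S) ha hψ

/-! ## §3 The dictionary at the named kernel -/

/-- **THE WEIL ↔ DBR DICTIONARY, named**: for every finite `S` and real `a`,
`G_S ⪰ 0` on finite configurations in `(−a, a)` iff `WeilSemilocalPositivityOn S a`. RH-FREE glue.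
[cite: Suzuki2023, (1.5) and Prop 3.1] -/
theorem isPosSemidefKernelOn_iff (a : ℝ) :
    IsPosSemidefKernelOn (semilocalKernel S) (Ioo (-a) a) ↔ WeilSemilocalPositivityOn S a :=
  isPosSemidefKernelOn_semilocalKernel_iff (semilocalScrew_eq S) a

/-- One-sided window: `T^S_ℓ ⪰ 0` (configurations in `(0, ℓ)`) iff `WeilSemilocalPositivityOn S (ℓ/2)` («ℓ = 2a»).
[cite: Suzuki2023, (1.5)] -/
theorem isPosSemidefKernelOn_Ioo_zero_iff (l : ℝ) :
    IsPosSemidefKernelOn (semilocalKernel S) (Ioo 0 l) ↔ WeilSemilocalPositivityOn S (l / 2) :=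
  isPosSemidefKernelOn_semilocalKernel_Ioo_zero_iff (semilocalScrew_eq S) l

/-- **`ℓ*(S) = 2·a*(S)`**: `T^S_ℓ ⪰ 0 ↔ ℓ ≤ 2·weilSemilocalThreshold S`.
[cite: Yoshida1992HermitianForms, Prop. 6 (p. 320), with the primes restricted to S] -/
theorem isPosSemidefKernelOn_Ioo_zero_iff_le (l : ℝ) :
    IsPosSemidefKernelOn (semilocalKernel S) (Ioo 0 l) ↔ l ≤ 2 * weilSemilocalThreshold S :=
  isPosSemidefKernelOn_semilocalKernel_Ioo_zero_iff_le (semilocalScrew_eq S) l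

/-- Symmetric-window form of the threshold: `G_S ⪰ 0` on `(−a, a)` iff `a ≤ weilSemilocalThreshold S`.
[cite: Yoshida1992HermitianForms, Prop. 6 (p. 320), with the primes restricted to S] -/
theorem isPosSemidefKernelOn_iff_le (a : ℝ) :
    IsPosSemidefKernelOn (semilocalKernel S) (Ioo (-a) a) ↔ a ≤ weilSemilocalThreshold S := by
  rw [isPosSemidefKernelOn_iff, weilSemilocalPositivityOn_iff_le_weilSemilocalThreshold]

/-- Monotonicity in the window (trivial, recorded for users): a positive string stays positive on sub-windows. [folklore] -/
theorem isPosSemidefKernelOn_Ioo_zero_mono {l l' : ℝ} (h : IsPosSemidefKernelOn (semilocalKernel S) (Ioo 0 l'))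
    (hl : l ≤ l') : IsPosSemidefKernelOn (semilocalKernel S) (Ioo 0 l) :=
  h.mono (Ioo_subset_Ioo_right hl)

/-- **`ℓ*(P_<q) = log q + 2·wallOffset q`**: `T^{P_<q}_ℓ ⪰ 0 ↔ ℓ ≤ log q + 2·wallOffset q`.
[cite: Yoshida1992HermitianForms, Prop. 6 (p. 320), with the primes restricted to S] -/
theorem isPosSemidefKernelOn_primesBelow_iff_le_wallOffset (q : ℕ) (l : ℝ) :
    IsPosSemidefKernelOn (semilocalKernel (Nat.primesBelow q)) (Ioo 0 l) ↔ l ≤ Real.log q + 2 * wallOffset q := by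
  rw [isPosSemidefKernelOn_Ioo_zero_iff_le, wallOffset]
  constructor <;> intro h <;> linarith

/-- **ET6's «`δ(q) ≥ 0`» IS Column WEIL's `0 ≤ wallOffset q`**: `0 ≤ wallOffset q ↔ T^{P_<q}_{log q} ⪰ 0`. RH-FREE per `q`.
[cite: Yoshida1992HermitianForms, Prop. 6 (p. 320), with the primes restricted to S] -/
theorem wallOffset_nonneg_iff (q : ℕ) :
    0 ≤ wallOffset q ↔ IsPosSemidefKernelOn (semilocalKernel (Nat.primesBelow q)) (Ioo 0 (Real.log q)) :=
  wallOffset_nonneg_iff_semilocalKernel (semilocalScrew_eq _)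

/-- A small certified wall offset is a DBR tie: `wallOffset q < ε`, `log q + 2ε ≤ ℓ` ⟹ `T^{P_<q}_ℓ` is NOT positive.
[cite: Yoshida1992HermitianForms, Prop. 6 (p. 320), with the primes restricted to S] -/
theorem not_isPosSemidefKernelOn_of_wallOffset_lt {q : ℕ} {ε l : ℝ} (hε : wallOffset q < ε)
    (hl : Real.log q + 2 * ε ≤ l) : ¬ IsPosSemidefKernelOn (semilocalKernel (Nat.primesBelow q)) (Ioo 0 l) := by
  rw [isPosSemidefKernelOn_primesBelow_iff_le_wallOffset, not_le]
  linarith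

/-- A non-negative wall offset is a DBR rung: `T^{P_<q}_{log q} ⪰ 0` («`δ(q) ≥ 0`»).
[cite: Yoshida1992HermitianForms, Prop. 6 (p. 320), with the primes restricted to S] -/
theorem isPosSemidefKernelOn_primesBelow_log_of_wallOffset_nonneg {q : ℕ} (h : 0 ≤ wallOffset q) :
    IsPosSemidefKernelOn (semilocalKernel (Nat.primesBelow q)) (Ioo 0 (Real.log q)) :=
  (wallOffset_nonneg_iff q).1 h

/-- The archimedean row in the same language: `ArchWallHolds ℓ ↔ T^∅_ℓ ⪰ 0`. [folklore] -/
theorem archWallHolds_iff (l : ℝ) : ArchWallHolds l ↔ IsPosSemidefKernelOn (semilocalKernel ∅) (Ioo 0 l) := by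
  rw [semilocalKernel_empty]; rfl

/-- The archimedean tie in the same language: `ArchWallTies ℓ ↔ ¬ T^∅_ℓ ⪰ 0`. [folklore] -/
theorem archWallTies_iff (l : ℝ) : ArchWallTies l ↔ ¬ IsPosSemidefKernelOn (semilocalKernel ∅) (Ioo 0 l) := by
  rw [semilocalKernel_empty]; rfl

/-- **The full form through the truncated string**: for `2a ≤ log q`, Suzuki's kernel is positive on `(−a, a)` iff
`G_{primes<q}` is (the two kernels coincide there). [cite: Suzuki2023, (1.4)–(1.5)] -/
theorem isPosSemidefKernelOn_zetaScrewKernel_iff_primesBelow {q : ℕ} (h2a : 2 * a ≤ Real.log q) :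
    IsPosSemidefKernelOn (fun t u : ℝ => (zetaScrewKernel t u : ℂ)) (Ioo (-a) a) ↔
      IsPosSemidefKernelOn (semilocalKernel (Nat.primesBelow q)) (Ioo (-a) a) :=
  isPosSemidefKernelOn_congr fun _ ht _ hu => zetaScrewKernel_eq_semilocalKernel h2a ht hu

/-- … hence `WeilPositivityOn a ↔ G_{primes<q} ⪰ 0 on (−a, a)` whenever `2a ≤ log q` (the full Weil rung read on a
truncated string that already sees every prime power below `e^{2a}`). [cite: Suzuki2023, (1.5) and Prop 3.1] -/
theorem weilPositivityOn_iff_primesBelow {q : ℕ} (h2a : 2 * a ≤ Real.log q) :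
    WeilPositivityOn a ↔ IsPosSemidefKernelOn (semilocalKernel (Nat.primesBelow q)) (Ioo (-a) a) := by
  rw [← isPosSemidefKernelOn_zetaScrewKernel_iff_weilPositivityOn, isPosSemidefKernelOn_zetaScrewKernel_iff_primesBelow h2a]

/-- RH-EQUIVALENT (labelled; NOT claimed): RH iff for every prime `q` the truncated string `T^{P_<q}_{log q}` is positive
(`= ∀ q, 0 ≤ wallOffset q`, Column WEIL's `riemannHypothesis_iff_forall_wallOffset_nonneg`).
[cite: Yoshida1992HermitianForms, Prop. 6 (p. 320) and Thm 2] -/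
theorem riemannHypothesis_iff :
    Summit.RiemannHypothesis ↔ ∀ q : ℕ, q.Prime →
      IsPosSemidefKernelOn (semilocalKernel (Nat.primesBelow q)) (Ioo 0 (Real.log q)) :=
  riemannHypothesis_iff_forall_semilocalKernel

/-! ## §4 The ET6 rows at the named strings (every row by name; RH-FREE; no recompute) -/

/-- Row `q = 3`, rung: `T^{P_<3}_{log 3} ⪰ 0` («`δ(3) ≥ 0`»; `wallOffset_three_nonneg`). [cite: Yoshida1992, Thm 1 (p. 310), §6 (method)] -/
theorem isPosSemidefKernelOn_primesBelow_three_log :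
    IsPosSemidefKernelOn (semilocalKernel (Nat.primesBelow 3)) (Ioo 0 (Real.log 3)) :=
  isPosSemidefKernelOn_primesBelow_log_of_wallOffset_nonneg wallOffset_three_nonneg

/-- Row `{2}`, rung to `277/250 = 1.108`: `T^{{2}}_{1.108} ⪰ 0` (`weilSemilocalPositivityOn_two_554`). [cite: Yoshida1992, Thm 1 (p. 310), §6 (method)] -/
theorem isPosSemidefKernelOn_two_1108 : IsPosSemidefKernelOn (semilocalKernel {2}) (Ioo 0 ((277 : ℝ) / 250)) := by
  rw [isPosSemidefKernelOn_Ioo_zero_iff]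
  convert weilSemilocalPositivityOn_two_554 using 1
  norm_num

/-- Row `{2}`, tie beyond `97/87 = 1.1149…`: `T^{{2}}_ℓ` is NOT positive for `ℓ > 97/87` (`weilSemilocalThreshold_two_le_055747`);
so `ℓ*({2}) ∈ [1.108, 97/87]`. [cite: Yoshida1992HermitianForms, Prop. 6 (p. 320), with the primes restricted to S] -/
theorem not_isPosSemidefKernelOn_two_of_gt {l : ℝ} (hl : (97 : ℝ) / 87 < l) :
    ¬ IsPosSemidefKernelOn (semilocalKernel {2}) (Ioo 0 l) := by
  rw [isPosSemidefKernelOn_Ioo_zero_iff_le, not_le]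
  have h := weilSemilocalThreshold_two_le_055747
  have e : (((97 / 174 : ℚ) : ℝ)) = 97 / 174 := by push_cast; ring
  rw [e] at h
  linarith

/-- Row `q = 5`, rung: `T^{P_<5}_{log 5} ⪰ 0` («`δ(5) ≥ 0`»; `wallOffset_five_nonneg`). [cite: Yoshida1992, Thm 1 (p. 310), §6 (method)] -/
theorem isPosSemidefKernelOn_primesBelow_five_log :
    IsPosSemidefKernelOn (semilocalKernel (Nat.primesBelow 5)) (Ioo 0 (Real.log 5)) :=
  isPosSemidefKernelOn_primesBelow_log_of_wallOffset_nonneg wallOffset_five_nonneg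

/-- Row `q = 5`, kinked tie: `T^{P_<5}_ℓ` NOT positive for `ℓ ≥ log 5 + 0.0126` («`δ(5) < 0.0126`»).
[cite: Yoshida1992HermitianForms, Prop. 6 (p. 320), with the primes restricted to S] -/
theorem not_isPosSemidefKernelOn_primesBelow_five {l : ℝ} (hl : Real.log 5 + 0.0126 ≤ l) :
    ¬ IsPosSemidefKernelOn (semilocalKernel (Nat.primesBelow 5)) (Ioo 0 l) :=
  not_isPosSemidefKernelOn_of_wallOffset_lt wallOffset_five_mem_Ico_00063.2 (by norm_num at hl ⊢; linarith)

/-- Rung for EVERY `S ⊇ {2, 3}`: `T^S_ℓ ⪰ 0` for `ℓ ≤ 4023/2500 = 1.6092` (below `log 5`, where the `S`-form is the full Weil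
form; Column WEIL's frontier rung `WeilPositivityOn (4023/5000)` through `SemilocalTwoThree.weilSemilocalPositivityOn_8046`).
[cite: Bombieri2000Weil, §4 (criterion); certificate in tree] -/
theorem isPosSemidefKernelOn_of_two_three_mem {S : Finset ℕ} (h2 : 2 ∈ S) (h3 : 3 ∈ S) :
    IsPosSemidefKernelOn (semilocalKernel S) (Ioo 0 ((4023 : ℝ) / 2500)) := by
  rw [isPosSemidefKernelOn_Ioo_zero_iff, show ((4023 : ℝ) / 2500) / 2 = 4023 / 5000 by norm_num]
  exact weilSemilocalPositivityOn_8046 h2 h3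

/-- Row `q = 7`, rung: `T^{P_<7}_{log 7} ⪰ 0` («`δ(7) ≥ 0`»; `wallOffset_seven_nonneg`, from `WeilPositivityOn 1`).
[cite: Yoshida1992, Thm 1 (p. 310), §6 (method)] -/
theorem isPosSemidefKernelOn_primesBelow_seven_log :
    IsPosSemidefKernelOn (semilocalKernel (Nat.primesBelow 7)) (Ioo 0 (Real.log 7)) :=
  isPosSemidefKernelOn_primesBelow_log_of_wallOffset_nonneg wallOffset_seven_nonneg

/-- Row `q = 7`, kinked tie: NOT positive for `ℓ ≥ log 7 + 0.0141` («`δ(7) < 0.0141`»).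
[cite: Yoshida1992HermitianForms, Prop. 6 (p. 320), with the primes restricted to S] -/
theorem not_isPosSemidefKernelOn_primesBelow_seven {l : ℝ} (hl : Real.log 7 + 0.0141 ≤ l) :
    ¬ IsPosSemidefKernelOn (semilocalKernel (Nat.primesBelow 7)) (Ioo 0 l) :=
  not_isPosSemidefKernelOn_of_wallOffset_lt wallOffset_seven_lt_000705 (by norm_num at hl ⊢; linarith)

/-- Row `q = 11`, kinked tie: NOT positive for `ℓ ≥ log 11 + 0.01412`. [cite: Yoshida1992HermitianForms, Prop. 6 (p. 320), with the primes restricted to S] -/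
theorem not_isPosSemidefKernelOn_primesBelow_eleven {l : ℝ} (hl : Real.log 11 + 0.01412 ≤ l) :
    ¬ IsPosSemidefKernelOn (semilocalKernel (Nat.primesBelow 11)) (Ioo 0 l) :=
  not_isPosSemidefKernelOn_of_wallOffset_lt wallOffset_eleven_lt_000706 (by norm_num at hl ⊢; linarith)

/-- Row `q = 13`, kinked tie: NOT positive for `ℓ ≥ log 13 + 0.0132`. [cite: Yoshida1992HermitianForms, Prop. 6 (p. 320), with the primes restricted to S] -/
theorem not_isPosSemidefKernelOn_primesBelow_thirteen {l : ℝ} (hl : Real.log 13 + 0.0132 ≤ l) :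
    ¬ IsPosSemidefKernelOn (semilocalKernel (Nat.primesBelow 13)) (Ioo 0 l) :=
  not_isPosSemidefKernelOn_of_wallOffset_lt wallOffset_thirteen_lt_00066 (by norm_num at hl ⊢; linarith)

/-- **Row `q = 17` singly** (NEW by name), kinked tie: `T^{P_<17}_ℓ` NOT positive for `ℓ ≥ log 17 + 0.01249` — «`δ(17) < 0.01249`»
(Column WEIL's `wallOffset_seventeen_lt_0006245`; certified two-engine value `δ(17) ≤ 0.00046`).
[cite: Yoshida1992HermitianForms, Prop. 6 (p. 320), with the primes restricted to S] -/
theorem not_isPosSemidefKernelOn_primesBelow_seventeen {l : ℝ} (hl : Real.log 17 + 0.01249 ≤ l) :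
    ¬ IsPosSemidefKernelOn (semilocalKernel (Nat.primesBelow 17)) (Ioo 0 l) :=
  not_isPosSemidefKernelOn_of_wallOffset_lt wallOffset_seventeen_lt_0006245 (by norm_num at hl ⊢; linarith)

/-- **Row `q = 19` singly** (NEW by name), kinked tie: NOT positive for `ℓ ≥ log 19 + 0.01064` — «`δ(19) < 0.01064`»
(`wallOffset_nineteen_lt_000532`; certified `δ(19) ≤ 0.00038`). [cite: Yoshida1992HermitianForms, Prop. 6 (p. 320), with the primes restricted to S] -/
theorem not_isPosSemidefKernelOn_primesBelow_nineteen {l : ℝ} (hl : Real.log 19 + 0.01064 ≤ l) :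
    ¬ IsPosSemidefKernelOn (semilocalKernel (Nat.primesBelow 19)) (Ioo 0 l) :=
  not_isPosSemidefKernelOn_of_wallOffset_lt wallOffset_nineteen_lt_000532 (by norm_num at hl ⊢; linarith)

/-- **Row `q = 23` singly** (NEW by name), kinked tie: NOT positive for `ℓ ≥ log 23 + 0.011` — «`δ(23) < 0.011`»
(`wallOffset_twentythree_lt_00055`; certified `δ(23) ≤ 0.00027`). [cite: Yoshida1992HermitianForms, Prop. 6 (p. 320), with the primes restricted to S] -/
theorem not_isPosSemidefKernelOn_primesBelow_twentythree {l : ℝ} (hl : Real.log 23 + 0.011 ≤ l) :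
    ¬ IsPosSemidefKernelOn (semilocalKernel (Nat.primesBelow 23)) (Ioo 0 l) :=
  not_isPosSemidefKernelOn_of_wallOffset_lt wallOffset_twentythree_lt_00055 (by norm_num at hl ⊢; linarith)

/-- Uniform kinked tie: for every prime `5 ≤ q ≤ 23`, `T^{P_<q}_ℓ` is NOT positive for `ℓ ≥ log q + 0.0142` — «`δ(q) < 0.0142`»
(`wallOffset_lt_00071_of_prime_le`). [cite: Yoshida1992HermitianForms, Prop. 6 (p. 320), with the primes restricted to S] -/
theorem not_isPosSemidefKernelOn_primesBelow_of_prime_le {q : ℕ} (hq : q.Prime) (h5 : 5 ≤ q) (h23 : q ≤ 23)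
    {l : ℝ} (hl : Real.log q + 0.0142 ≤ l) :
    ¬ IsPosSemidefKernelOn (semilocalKernel (Nat.primesBelow q)) (Ioo 0 l) :=
  not_isPosSemidefKernelOn_of_wallOffset_lt (wallOffset_lt_00071_of_prime_le hq h5 h23) (by norm_num at hl ⊢; linarith)

end Semilocal

end Summit.RiemannHypothesis.RiemannHypothesis.Theorems.ZetaStringArchWall

end
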